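import Literature.Barriers.SmoothPoincare4.ExoticContractibleProofs
import Literature.Topology.FourManifolds.CobordismAttachment
import Literature.Topology.FourManifolds.CorkDecomposition
import HarnessLib

/-!
# Proof architecture of Akbulut–Ruberman's Theorem A (contractible case)

Second-level sibling proof file of `Literature/Barriers/SmoothPoincare4/ExoticContractible.lean`
(barrier `ContractibleBarrierFour`). The first-level file `ExoticContractibleProofs.lean` proves
Thm. B of Akbulut–Ruberman 2016 — hence the barrier — from three leaves, one of which is the named
fact `akbulutRuberman2016_theoremA_contractible` (Thm. A of loc. cit. for a contractible `W`). This
file decomposes THAT leaf along its printed proof (loc. cit. §§2–3) into three named facts (plus the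
attachment fact (G) of `CobordismAttachment.lean`) and PROVES the assembly
(`akbulutRuberman2016_construction_contractible_of_parts`,
`akbulutRuberman2016_theoremA_contractible_of_parts`); the purely formal step of the printed proof —
Lemma 1.2 of §1.1, "relative = absolute when every boundary diffeomorphism extends" — is proved
outright (`akbulutRuberman2016_lemma12`).

## The printed proof (arXiv:1410.1461v3 = Comment. Math. Helv. 91 (2016) 1–19)

§2, after Lemma 2.3: "Start with a relatively exotic manifold `(W, f)` with `f` the restriction of
a homeomorphism `F : W → W`. Form the union `V = W ∪_M X`, where `X` is an invertible homology
cobordism from `M = ∂W` to some other 3-manifold `N`. We will construct `X` using Lemma 2.3, so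
`V` will be homotopy equivalent to `W`. Cutting out the embedded copy of `W` in `V` and regluing via
`f` results in a manifold `V′`, and the invertibility of `X` will show that `V′` is exotic relative
to the identity marking on `∂V′ = N`. To show that `V′` is absolutely exotic, we will choose `N`
carefully so that all of its self-diffeomorphisms extend over `V′`. Philosophically, we use the
invertible homology cobordism to 'kill' the symmetry of `M`."

§3, proof of Thm. A: with `L ⊂ M` a link with hyperbolic, asymmetric complement (Cor. 2.5, after
Paoluzzi–Porti and Myers) and `C` the invertible concordance from the unknot to the doubly slice,
hyperbolic, asymmetric knot `J = 11n42` (Prop. 2.6, computer-certified), `X` is the homology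
cobordism of Lemma 2.3, with `π₁(M) → π₁(X)` an isomorphism. **Claim**: "The group of
diffeomorphisms of `N` mod isotopy is isomorphic to `⊕ⁿ (ℤ ⊕ ℤ)`, and every element extends over
the cobordism `X` in such a way that it is isotopic to the identity on `M`" (JSJ decomposition,
Waldhausen). Then: "Write `V′` for `X ∪_f W` … If `V′` were diffeomorphic to `V`, preserving this
marking, then we could glue this diffeomorphism to the identity of `X̄` to get a diffeomorphism
`X̄ ∪_N X ∪_f W ≅ W` (E:twist). But `X̄ ∪_N X ≅ N × I` … and hence `f` extends to `X̄ ∪_N X`. It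
follows that (E:twist) would result in a diffeomorphism of `(W, f)` with `(W, id)`, contradicting
[Akbulut 1991]. Since `V` and `V′` are simply connected homology balls, they are contractible, hence
homeomorphic. By the claim above and Lemma 1.2, there is no diffeomorphism between `V` and `V′`."

Lemma 1.2 (§1.1): "Suppose that every self-diffeomorphism of `∂W` extends to a diffeomorphism of
`W`. Then the natural forgetful map from relative to absolute smoothings of `W` is a bijection."

## What this file vendors and proves

With the vocabulary of `Literature/Topology/FourManifolds/CobordismAttachment.lean`
(`CobordismAttachment b X ψ V`: "`V = W ∪_ψ X`", `Cobordism.IsInvertible`: Def. 2.1) and the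
predicate `FarEndDiffeosExtend X` below (the conclusion of the Claim for `X`):

* (C) `akbulutRuberman2016_symmetryKillingCobordism` — §3 ¶1 with the Claim, for `M = ∂W`, `W`
  compact contractible: there is a cobordism `X` from `∂W` to some `N` which is invertible, has the
  extension property of the Claim, and is such that `W ∪_ψ X` is contractible for every `ψ`
  ("simply connected homology balls"). Leaves below it (Lemma 2.3, Prop. 2.4/Cor. 2.5, Prop. 2.6,
  JSJ/Waldhausen, van Kampen/Mayer–Vietoris/Whitehead) have no vocabulary in the tree (hyperbolic
  3-manifolds, symmetry groups, doubly slice knots) and are not vendored separately.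
* (G) `Literature.Topology.FourManifolds.exists_cobordismAttachment` (that file) — `W ∪_ψ X`
  exists (Milnor 1965, Thm. 1.4).
* (R) `akbulutRuberman2016_relativelyExotic` — the "(E:twist)" paragraph: for an invertible `X`,
  a diffeomorphism `V′ = W ∪_f X → V = W ∪_{id} X` preserving the `N`-markings forces `f` to extend
  to a self-diffeomorphism of `W`.
* (S) `akbulutRuberman2016_boundaryDiffeosExtend` — "By the claim above and Lemma 1.2": if `X`
  has the extension property of the Claim then every self-diffeomorphism of `∂V′ = N` extends to a
  self-diffeomorphism of `V′ = W ∪_f X` (the hypothesis of Lemma 1.2 for `V′`).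
* PROVED: `akbulutRuberman2016_lemma12` (the mechanism of Lemma 1.2: under (S)'s conclusion every
  diffeomorphism `V ≅ V′` can be corrected to one preserving a given boundary identification);
  the construction of §§2–3 — the pair `V = W ∪_{id} X`, `V′ = W ∪_f X` of compact contractible
  manifolds with `∂V = N = ∂V′` and its two properties (every self-diffeomorphism of `∂V′`
  extends over `V′`; a marking-compatible diffeomorphism `V ≅ V′` forces `f` to extend) — from
  (C), (G), (R), (S), as a THEOREM with an explicit statement
  (`akbulutRuberman2016_construction_contractible_of_parts`; this intermediate node of the printed
  proof was first vendored as a named fact `akbulutRuberman2016_construction_contractible` and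
  was merged back on review, D-0026/D-0027: it is not a leaf, its whole content beyond the proved
  parts (G), (S) is (C) ∧ (R), which keep their own names); Thm. A (contractible) from the four
  parts through that theorem and Lemma 1.2 (`akbulutRuberman2016_theoremA_contractible_of_parts`);
  hence also Thm. B and the barrier from the parts, a cork and Freedman–Quinn
  (`contractibleBarrierFour_of_parts`).

Resulting DAG (all arrows proved in the tree; the leaves (G) and (S) are discharged in
`CobordismAttachmentProofs.lean` and `ExoticContractibleBoundaryDiffeosProofs.lean`):
`akbulutRuberman2016_theoremA_contractible ⇐ (C) ∧ (G) ∧ (R) ∧ (S)`.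

## Rendering choices (wording risks for the reviewer)

* The Claim is rendered through its USE: `FarEndDiffeosExtend X` says that every
  self-diffeomorphism `g` of `N` is isotopic to the far-end restriction of a self-diffeomorphism
  `G` of `X` whose near-end restriction is isotopic to the identity of `M` ("every element
  [of `π₀ Diff(N)`] extends over the cobordism `X` in such a way that it is isotopic to the identity
  on `M`"); the computation `π₀ Diff(N) ≅ ⊕ⁿ(ℤ ⊕ ℤ)` itself is not vendored. Isotopy is the tree's
  `Literature.Topology.FourManifolds.Diffeomorph.IsIsotopic` (smooth isotopy through embeddings;
  for closed `N` the same as diffeotopy).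
* (R) and (S) are stated for EVERY witness `V`, `V′` of the attachments (the tree's relational
  style; by the uniqueness half of Milnor's Thm. 1.4 all witnesses are diffeomorphic relative to
  the pieces away from the seam), for every compact `W` (contractibility is not used in these two
  steps of the printed proof) and with the smooth pasting along seams and collars that the printed
  proof leaves implicit; their citations are the printed sentences they render.
* (C) is stated for `M = ∂W` with `W` compact contractible (the case of Thm. B), which makes `M` a
  closed, connected, orientable 3-manifold as Prop. 2.4 requires, without orientation vocabulary;
  its contractibility clause quantifies over all Hausdorff witnesses of `W ∪_ψ X` (all homeomorphic
  to the topological pushout).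
* Thm. A's clause "`W` contains `V`, `V′`" stays dropped, as in the decomposed fact.

## References

[AkbulutRuberman2016] [MilnorHCobordism1965] [HirschDT1976] [FreedmanQuinn1990] [Akbulut1991Fake]
-/

noncomputable section

open scoped Manifold ContDiff
open Function Set
open Literature.Topology.FourManifolds

namespace Literature.Barriers.SmoothPoincare4

universe u

/-- Local notation: `𝔼 n` is the model Euclidean space `EuclideanSpace ℝ (Fin n)`. -/
local notation "𝔼 " n:arg => EuclideanSpace ℝ (Fin n)

/-- Local notation: `ℍ n` is the closed half space `EuclideanHalfSpace n`. -/
local notation "ℍ " n:arg => EuclideanHalfSpace n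

/-! ### The extension property of the Claim (§3) -/

section Claim

variable {M N : Type u} [TopologicalSpace M] [ChartedSpace (𝔼 3) M]
  [TopologicalSpace N] [ChartedSpace (𝔼 3) N]

/-- **The extension property of the Claim in the proof of Thm. A** for a cobordism `X` from `M`
to `N` (dimension `3 + 1`): every self-diffeomorphism `g` of the far end `N` extends over `X` up
to isotopy, inducing on the near end `M` a diffeomorphism isotopic to the identity — there are a
self-diffeomorphism `G` of `X.W` and diffeomorphisms `g′` of `N`, `k` of `M` with
`G ∘ inr = inr ∘ g′`, `G ∘ inl = inl ∘ k`, `g′` isotopic to `g` and `k` isotopic to `id_M`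
("every element [of the group of diffeomorphisms of `N` mod isotopy] extends over the cobordism
`X` in such a way that it is isotopic to the identity on `M`"). Isotopy is
`Literature.Topology.FourManifolds.Diffeomorph.IsIsotopic`.
[cite: AkbulutRuberman2016, §3, proof of Thm. A, Claim] -/
def FarEndDiffeosExtend (X : Cobordism 3 M N) : Prop :=
  ∀ g : N ≃ₘ⟮𝓡 3, 𝓡 3⟯ N,
    ∃ (G : X.W ≃ₘ⟮𝓡∂ 4, 𝓡∂ 4⟯ X.W) (g' : N ≃ₘ⟮𝓡 3, 𝓡 3⟯ N) (k : M ≃ₘ⟮𝓡 3, 𝓡 3⟯ M),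
      (∀ y, G (X.inr y) = X.inr (g' y)) ∧ (∀ x, G (X.inl x) = X.inl (k x)) ∧
      Literature.Topology.FourManifolds.Diffeomorph.IsIsotopic g' g ∧
      Literature.Topology.FourManifolds.Diffeomorph.IsIsotopic k (Diffeomorph.refl (𝓡 3) M ∞)

/-- If every far-end diffeomorphism extends over `X` ON THE NOSE, as the identity on the near
end, then `X` has the extension property of the Claim (with `g′ = g`, `k = id`; reflexivity of
isotopy is the tree's `Diffeomorph.IsIsotopic.refl_holds`). [folklore] -/
theorem farEndDiffeosExtend_of_forall_exists [IsManifold (𝓡 3) ∞ N] [IsManifold (𝓡 3) ∞ M]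
    (X : Cobordism 3 M N)
    (h : ∀ g : N ≃ₘ⟮𝓡 3, 𝓡 3⟯ N, ∃ G : X.W ≃ₘ⟮𝓡∂ 4, 𝓡∂ 4⟯ X.W,
      (∀ y, G (X.inr y) = X.inr (g y)) ∧ ∀ x, G (X.inl x) = X.inl x) :
    FarEndDiffeosExtend X := by
  intro g
  obtain ⟨G, hN, hM⟩ := h g
  exact ⟨G, g, Diffeomorph.refl (𝓡 3) M ∞, hN, fun x => by simpa using hM x,
    Literature.Topology.FourManifolds.Diffeomorph.IsIsotopic.refl_holds g,
    Literature.Topology.FourManifolds.Diffeomorph.IsIsotopic.refl_holds _⟩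

end Claim

/-! ### Named facts: the three geometric ingredients of the proof of Thm. A -/

/-- **Akbulut–Ruberman 2016, §3 ¶1 with the Claim: the symmetry-killing invertible cobordism
(named fact).** For every compact (Hausdorff, second countable) contractible smooth 4-manifold `W`
with boundary datum `b` (`M = ∂W`, a closed connected orientable 3-manifold), there are a smooth
3-manifold `N` and a cobordism `X` from `∂W` to `N` such that (i) `X` is invertible
(`Cobordism.IsInvertible`, Def. 2.1), (ii) `X` has the extension property of the Claim
(`FarEndDiffeosExtend X`), and (iii) for every self-diffeomorphism `ψ` of `∂W`, every (Hausdorff)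
`V = W ∪_ψ X` is contractible. Printed: `X = M × I - (L × D² × I) ∪ ∐ᵢ (S³ × I - Cᵢ × D²)`
(Lemma 2.3: "Then `X` is an invertible homology cobordism from `M` to a 3-manifold `N`. If
`π₁(S³ × I - Cᵢ) ≅ ℤ`, then the inclusion `M → X` induces an isomorphism on fundamental groups")
for the link `L ⊂ M` of Cor. 2.5 ("Any orientable 3-manifold `M` contains a link `L` with
hyperbolic complement, such that the symmetry group of `M - L` is trivial", after Paoluzzi–Porti)
and the concordance `C` from the unknot to `J = 11n42` of Prop. 2.6 ("hyperbolic with trivial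
symmetry group and doubly slice, where the complement of each slice disk has fundamental group
`ℤ`", computer-certified); (ii) is the Claim of §3 (JSJ decomposition of `N` along the tori `𝕋`,
Waldhausen); (iii) is "so `V` will be homotopy equivalent to `W`" (§2) / "Since `V` and `V′` are
simply connected homology balls, they are contractible" (§3). None of the 3-manifold inputs
(hyperbolic structures, symmetry groups, JSJ, doubly slice knots) has vocabulary in Mathlib or the
tree; this is the deep leaf of Thm. A. Users take `(h : akbulutRuberman2016_symmetryKillingCobordism)`.
[cite: AkbulutRuberman2016, §3 (proof of Thm. A, first paragraph and Claim), Lemma 2.3, Cor. 2.5, Prop. 2.6] -/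
def akbulutRuberman2016_symmetryKillingCobordism : Prop :=
  ∀ (W : Type u) [TopologicalSpace W] [T2Space W] [SecondCountableTopology W]
    [ChartedSpace (ℍ 4) W] [IsManifold (𝓡∂ 4) ∞ W] [CompactSpace W] [ContractibleSpace W]
    (b : BoundaryData (𝓡∂ 4) W (𝓡 3)),
    ∃ (N : Type u) (_ : TopologicalSpace N) (_ : ChartedSpace (𝔼 3) N) (_ : IsManifold (𝓡 3) ∞ N)
      (X : Cobordism 3 b.carrier N),
      X.IsInvertible ∧ FarEndDiffeosExtend X ∧
      ∀ (ψ : b.carrier ≃ₘ⟮𝓡 3, 𝓡 3⟯ b.carrier) (V : Type u) [TopologicalSpace V] [T2Space V]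
        [ChartedSpace (ℍ 4) V], Nonempty (CobordismAttachment b X ψ V) → ContractibleSpace V

/-- **Akbulut–Ruberman 2016, §3: relative exoticness from invertibility (named fact).** Let `W`
be a compact (Hausdorff, second countable) smooth 4-manifold with boundary datum `b`, `f` a
self-diffeomorphism of `∂W`, and `X` an INVERTIBLE cobordism from `∂W` to `N`
(`Cobordism.IsInvertible`, Def. 2.1). Let `V = W ∪_{id} X` and `V′ = W ∪_f X` (any witnesses
`A`, `A′` of the attachments, `CobordismAttachment`), both with boundary `N` marked by
`jX ∘ X.inr`. If there is a diffeomorphism `Φ : V′ ≅ V` preserving these markings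
(`Φ (jX′ (inr y)) = jX (inr y)`), then `f` extends to a self-diffeomorphism of `W`
(`Literature.Topology.FourManifolds.ExtendsToDiffeomorph b f`). Printed: "If `V′` were
diffeomorphic to `V`, preserving this marking, then we could glue this diffeomorphism to the
identity of `X̄` to get a diffeomorphism `X̄ ∪_N X ∪_f W ≅ W`. But `X̄ ∪_N X ≅ N × I` (relative to
the identity on the boundary) and hence `f` extends to `X̄ ∪_N X`. It follows that [this] would
result in a diffeomorphism of `(W, f)` with `(W, id)`" — i.e. `V′` is exotic relative to the
identity marking of `∂V′ = N` unless `f` extends; the smooth pasting along `N` and the absorption of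
the collar `M × I` into `W` (Milnor 1965, Thm. 1.4; collars) are implicit in print. Stated for
every compact `W` (Thm. A is; contractibility plays no role in this step). Users take
`(h : akbulutRuberman2016_relativelyExotic)`.
[cite: AkbulutRuberman2016, §3, proof of Thm. A (the paragraph "Write V′ for X ∪_f W …")] [cite: MilnorHCobordism1965, §1, Thm. 1.4] -/
def akbulutRuberman2016_relativelyExotic : Prop :=
  ∀ (W : Type u) [TopologicalSpace W] [T2Space W] [SecondCountableTopology W]
    [ChartedSpace (ℍ 4) W] [IsManifold (𝓡∂ 4) ∞ W] [CompactSpace W]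
    (b : BoundaryData (𝓡∂ 4) W (𝓡 3)) (f : b.carrier ≃ₘ⟮𝓡 3, 𝓡 3⟯ b.carrier)
    (N : Type u) [TopologicalSpace N] [ChartedSpace (𝔼 3) N] [IsManifold (𝓡 3) ∞ N]
    (X : Cobordism 3 b.carrier N), X.IsInvertible →
    ∀ (V : Type u) [TopologicalSpace V] [T2Space V] [SecondCountableTopology V]
      [ChartedSpace (ℍ 4) V] [IsManifold (𝓡∂ 4) ∞ V]
      (V' : Type u) [TopologicalSpace V'] [T2Space V'] [SecondCountableTopology V']
      [ChartedSpace (ℍ 4) V'] [IsManifold (𝓡∂ 4) ∞ V']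
      (A : CobordismAttachment b X (Diffeomorph.refl (𝓡 3) b.carrier ∞) V)
      (A' : CobordismAttachment b X f V'),
      (∃ Φ : V' ≃ₘ⟮𝓡∂ 4, 𝓡∂ 4⟯ V, ∀ y : N, Φ (A'.jX (X.inr y)) = A.jX (X.inr y)) →
      ExtendsToDiffeomorph b f

/-- **Akbulut–Ruberman 2016, §3: the boundary symmetries of `V′ = W ∪_f X` all extend (named
fact).** Let `W` be a compact (Hausdorff, second countable) smooth 4-manifold with boundary datum
`b`, `f` a self-diffeomorphism of `∂W`, and `X` a cobordism from `∂W` to `N` with the extension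
property of the Claim (`FarEndDiffeosExtend X`: every self-diffeomorphism of `N` extends over `X`
up to isotopy, as a diffeomorphism isotopic to the identity on `∂W`). Then for every witness `A′` of
`V′ = W ∪_f X` (`CobordismAttachment`), every self-diffeomorphism `g` of `∂V′ = N` extends to a
self-diffeomorphism of `V′` (`ExtendsToDiffeomorph A′.boundaryData g`) — the hypothesis of
Lemma 1.2 for `V′`, which the printed proof invokes as "By the claim above and Lemma 1.2, there is
no diffeomorphism between `V` and `V′`" (and announces in §2: "we will choose `N` carefully so
that all of its self-diffeomorphisms extend over `V′`", in §1.1: "We will give another example [of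
the hypothesis of Lemma 1.2] as part of our main theorem"). The isotopies of the Claim are absorbed
in collars of `N ⊂ X` and `∂W ⊂ W` (a diffeomorphism isotopic to the identity of the boundary
extends over a collar) and the two extensions are pasted smoothly along the seam; these standard
steps are implicit in print. Stated for every compact `W`. Users take
`(h : akbulutRuberman2016_boundaryDiffeosExtend)`.
[cite: AkbulutRuberman2016, §3, proof of Thm. A ("By the claim above and Lemma 1.2 …") and §2] [cite: MilnorHCobordism1965, §1, Thm. 1.4] -/
def akbulutRuberman2016_boundaryDiffeosExtend : Prop :=
  ∀ (W : Type u) [TopologicalSpace W] [T2Space W] [SecondCountableTopology W]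
    [ChartedSpace (ℍ 4) W] [IsManifold (𝓡∂ 4) ∞ W] [CompactSpace W]
    (b : BoundaryData (𝓡∂ 4) W (𝓡 3)) (f : b.carrier ≃ₘ⟮𝓡 3, 𝓡 3⟯ b.carrier)
    (N : Type u) [TopologicalSpace N] [ChartedSpace (𝔼 3) N] [IsManifold (𝓡 3) ∞ N]
    (X : Cobordism 3 b.carrier N), FarEndDiffeosExtend X →
    ∀ (V' : Type u) [TopologicalSpace V'] [T2Space V'] [SecondCountableTopology V']
      [ChartedSpace (ℍ 4) V'] [IsManifold (𝓡∂ 4) ∞ V'] (A' : CobordismAttachment b X f V')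
      (g : N ≃ₘ⟮𝓡 3, 𝓡 3⟯ N), ExtendsToDiffeomorph A'.boundaryData g

/-! ### Lemma 1.2: relative versus absolute (proved) -/

/-- **Akbulut–Ruberman 2016, Lemma 1.2 (the mechanism, proved).** If every self-diffeomorphism of
`∂V′` extends to a self-diffeomorphism of `V′` (hypothesis `hS`), then every diffeomorphism
`Φ : V ≅ V′` can be corrected to one that restricts to a PRESCRIBED identification `ν : ∂V ≅ ∂V′`
of the boundaries: compose `Φ` with an extension of `ν ∘ (∂Φ)⁻¹`, where
`∂Φ = bV.restrictDiffeomorph bV′ Φ` is the restriction of `Φ` to the boundary data (tree,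
`CorkDecomposition.lean`). This is why "the natural forgetful map from relative to absolute
smoothings is a bijection" under that hypothesis (injectivity; surjectivity is tautological): an
absolute diffeomorphism is upgraded to a relative one. No hypothesis on `V`, `V′` beyond
smoothness is needed. [cite: AkbulutRuberman2016, Lemma 1.2] -/
theorem akbulutRuberman2016_lemma12 {V V' : Type u} [TopologicalSpace V] [ChartedSpace (ℍ 4) V]
    [IsManifold (𝓡∂ 4) ∞ V] [TopologicalSpace V'] [ChartedSpace (ℍ 4) V'] [IsManifold (𝓡∂ 4) ∞ V']
    (bV : BoundaryData (𝓡∂ 4) V (𝓡 3)) (bV' : BoundaryData (𝓡∂ 4) V' (𝓡 3))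
    (ν : bV.carrier ≃ₘ⟮𝓡 3, 𝓡 3⟯ bV'.carrier)
    (hS : ∀ g : bV'.carrier ≃ₘ⟮𝓡 3, 𝓡 3⟯ bV'.carrier, ExtendsToDiffeomorph bV' g)
    (Φ : V ≃ₘ⟮𝓡∂ 4, 𝓡∂ 4⟯ V') :
    ∃ Ψ : V ≃ₘ⟮𝓡∂ 4, 𝓡∂ 4⟯ V', ∀ z, Ψ (bV.incl z) = bV'.incl (ν z) := by
  obtain ⟨G, hG⟩ := hS ((bV.restrictDiffeomorph bV' Φ).symm.trans ν)
  refine ⟨Φ.trans G, fun z => ?_⟩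
  have h1 : Φ (bV.incl z) = bV'.incl (bV.restrictDiffeomorph bV' Φ z) :=
    (BoundaryData.incl_restrictDiffeomorph Φ z).symm
  rw [Diffeomorph.coe_trans, comp_apply, h1, hG]
  simp

/-- **Lemma 1.2, contrapositive form used in §3**: if every self-diffeomorphism of `∂V′` extends
over `V′` and NO diffeomorphism `V ≅ V′` restricts to the identification `ν` of the boundaries
(relative exoticness), then `V` and `V′` are not diffeomorphic at all (absolute exoticness).
[cite: AkbulutRuberman2016, Lemma 1.2 and §3 ("By the claim above and Lemma 1.2 …")] -/
theorem isEmpty_diffeomorph_of_lemma12 {V V' : Type u} [TopologicalSpace V] [ChartedSpace (ℍ 4) V]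
    [IsManifold (𝓡∂ 4) ∞ V] [TopologicalSpace V'] [ChartedSpace (ℍ 4) V'] [IsManifold (𝓡∂ 4) ∞ V']
    (bV : BoundaryData (𝓡∂ 4) V (𝓡 3)) (bV' : BoundaryData (𝓡∂ 4) V' (𝓡 3))
    (ν : bV.carrier ≃ₘ⟮𝓡 3, 𝓡 3⟯ bV'.carrier)
    (hS : ∀ g : bV'.carrier ≃ₘ⟮𝓡 3, 𝓡 3⟯ bV'.carrier, ExtendsToDiffeomorph bV' g)
    (hR : ∀ Ψ : V ≃ₘ⟮𝓡∂ 4, 𝓡∂ 4⟯ V', ¬ ∀ z, Ψ (bV.incl z) = bV'.incl (ν z)) :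
    IsEmpty (V ≃ₘ⟮𝓡∂ 4, 𝓡∂ 4⟯ V') := by
  refine ⟨fun Φ => ?_⟩
  obtain ⟨Ψ, hΨ⟩ := akbulutRuberman2016_lemma12 bV bV' ν hS Φ
  exact hR Ψ hΨ

/-! ### Assembly: the construction of §§2–3 and Thm. A (contractible) from the parts -/

/-- Dimension-4 instance of the attachment fact `exists_cobordismAttachment` (which is indexed by
`n + 2`; here `n = 2`). [cite: MilnorHCobordism1965, §1, Thm. 1.4] -/
theorem exists_cobordismAttachment_four (hG : exists_cobordismAttachment.{u})
    (W : Type u) [TopologicalSpace W] [T2Space W] [SecondCountableTopology W]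
    [ChartedSpace (ℍ 4) W] [IsManifold (𝓡∂ 4) ∞ W] [CompactSpace W]
    (b : BoundaryData (𝓡∂ 4) W (𝓡 3)) (M N : Type u) [TopologicalSpace M] [ChartedSpace (𝔼 3) M]
    [IsManifold (𝓡 3) ∞ M] [TopologicalSpace N] [ChartedSpace (𝔼 3) N] [IsManifold (𝓡 3) ∞ N]
    (X : Cobordism 3 M N) (ψ : b.carrier ≃ₘ⟮𝓡 3, 𝓡 3⟯ M) :
    ∃ (V : Type u) (_ : TopologicalSpace V) (_ : T2Space V) (_ : SecondCountableTopology V)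
      (_ : ChartedSpace (ℍ 4) V) (_ : IsManifold (𝓡∂ 4) ∞ V),
      Nonempty (CobordismAttachment b X ψ V) :=
  hG 2 W b M N X ψ

/-- **The construction of §§2–3: the pair `V`, `V′` and its two properties, from the four parts.**
For every compact (Hausdorff, second countable) contractible smooth 4-manifold `W` with boundary
datum `b` and every self-diffeomorphism `f` of `∂W`, the parts (C), (G), (R), (S) give compact
contractible smooth 4-manifolds `V`, `V′` with boundary data `bV`, `bV′` and an identification
`ν : ∂V ≅ ∂V′` such that every self-diffeomorphism of `∂V′` extends to a self-diffeomorphism of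
`V′` ("we will choose `N` carefully so that all of its self-diffeomorphisms extend over `V′`",
§2) and a diffeomorphism `V ≅ V′` compatible with `ν` on the boundary exists only if `f` extends to
a self-diffeomorphism of `W` ("`V′` is exotic relative to the identity marking on `∂V′ = N`",
§§2–3) — the conjunction of what §3 establishes about `V = W ∪_M X`, `V′ = X ∪_f W` before
invoking Lemma 1.2. Proof, as printed: attach the symmetry-killing cobordism `X` of (C) to `W`
along the identity (`V`) and along `f` (`V′`) by (G); both are compact (the pieces are) and
contractible ((C)(iii)); `∂V = N = ∂V′` via `CobordismAttachment.boundaryData` and `ν = id_N`;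
(S) gives the extension of boundary diffeomorphisms of `V′`, and (R) — applied to the inverse of a
`ν`-compatible `Φ : V ≅ V′` — the extension of `f`.
[cite: AkbulutRuberman2016, §2 (paragraph after Lemma 2.3) and §3 (proof of Thm. A)] -/
theorem akbulutRuberman2016_construction_contractible_of_parts
    (hC : akbulutRuberman2016_symmetryKillingCobordism.{u})
    (hG : exists_cobordismAttachment.{u})
    (hR : akbulutRuberman2016_relativelyExotic.{u})
    (hS : akbulutRuberman2016_boundaryDiffeosExtend.{u})
    (W : Type u) [TopologicalSpace W] [T2Space W] [SecondCountableTopology W]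
    [ChartedSpace (ℍ 4) W] [IsManifold (𝓡∂ 4) ∞ W] [CompactSpace W] [ContractibleSpace W]
    (b : BoundaryData (𝓡∂ 4) W (𝓡 3)) (f : b.carrier ≃ₘ⟮𝓡 3, 𝓡 3⟯ b.carrier) :
    ∃ (V V' : Type u) (_ : TopologicalSpace V) (_ : T2Space V) (_ : SecondCountableTopology V)
      (_ : ChartedSpace (ℍ 4) V) (_ : IsManifold (𝓡∂ 4) ∞ V) (_ : CompactSpace V)
      (_ : ContractibleSpace V)
      (_ : TopologicalSpace V') (_ : T2Space V') (_ : SecondCountableTopology V')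
      (_ : ChartedSpace (ℍ 4) V') (_ : IsManifold (𝓡∂ 4) ∞ V') (_ : CompactSpace V')
      (_ : ContractibleSpace V')
      (bV : BoundaryData (𝓡∂ 4) V (𝓡 3)) (bV' : BoundaryData (𝓡∂ 4) V' (𝓡 3))
      (ν : bV.carrier ≃ₘ⟮𝓡 3, 𝓡 3⟯ bV'.carrier),
      (∀ g : bV'.carrier ≃ₘ⟮𝓡 3, 𝓡 3⟯ bV'.carrier, ExtendsToDiffeomorph bV' g) ∧
      ∀ Φ : V ≃ₘ⟮𝓡∂ 4, 𝓡∂ 4⟯ V', (∀ z, Φ (bV.incl z) = bV'.incl (ν z)) →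
        ExtendsToDiffeomorph b f := by
  obtain ⟨N, _, _, _, X, hInv, hFar, hContr⟩ := hC W b
  obtain ⟨V, _, _, _, _, _, ⟨A⟩⟩ :=
    exists_cobordismAttachment_four hG W b b.carrier N X (Diffeomorph.refl (𝓡 3) b.carrier ∞)
  obtain ⟨V', _, _, _, _, _, ⟨A'⟩⟩ := exists_cobordismAttachment_four hG W b b.carrier N X f
  haveI : CompactSpace V := A.compactSpace
  haveI : CompactSpace V' := A'.compactSpace
  haveI : ContractibleSpace V := hContr _ V ⟨A⟩
  haveI : ContractibleSpace V' := hContr f V' ⟨A'⟩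
  refine ⟨V, V', ‹_›, ‹_›, ‹_›, ‹_›, ‹_›, ‹_›, ‹_›, ‹_›, ‹_›, ‹_›, ‹_›, ‹_›, ‹_›, ‹_›,
    A.boundaryData, A'.boundaryData, Diffeomorph.refl (𝓡 3) N ∞, ?_, ?_⟩
  · exact hS W b f N X hFar V' A'
  · intro Φ hΦ
    refine hR W b f N X hInv V V' A A' ⟨Φ.symm, fun y => ?_⟩
    have h : Φ (A.jX (X.inr y)) = A'.jX (X.inr y) := hΦ y
    rw [← h, Diffeomorph.symm_apply_apply]

/-- **Akbulut–Ruberman 2016, Thm. A for contractible `W`, from the four parts of its printed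
proof**: the symmetry-killing invertible cobordism (C), existence of attachments (G), relative
exoticness from invertibility (R), extension of boundary symmetries from the Claim (S). Given a
boundary diffeomorphism `f` of a compact contractible `W` that extends to no self-diffeomorphism
(hypothesis of Thm. A; the homeomorphic extension is not used), the `V`, `V′` of the construction
(`akbulutRuberman2016_construction_contractible_of_parts`) have diffeomorphic boundaries (`ν`)
and are not diffeomorphic: a diffeomorphism `V ≅ V′` would by Lemma 1.2
(`akbulutRuberman2016_lemma12`, fed with the first property) be correctable to one compatible
with `ν`, whence by the second property `f` would extend ("By the claim above and Lemma 1.2,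
there is no diffeomorphism between `V` and `V′`"). [cite: AkbulutRuberman2016, Thm. A and §3] -/
theorem akbulutRuberman2016_theoremA_contractible_of_parts
    (hC : akbulutRuberman2016_symmetryKillingCobordism.{u})
    (hG : exists_cobordismAttachment.{u})
    (hR : akbulutRuberman2016_relativelyExotic.{u})
    (hS : akbulutRuberman2016_boundaryDiffeosExtend.{u}) :
    akbulutRuberman2016_theoremA_contractible.{u} := by
  intro W _ _ _ _ _ _ _ b f _ hD
  obtain ⟨V, V', _, _, _, _, _, _, _, _, _, _, _, _, _, _, bV, bV', ν, hS', hR'⟩ :=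
    akbulutRuberman2016_construction_contractible_of_parts hC hG hR hS W b f
  exact ⟨V, V', ‹_›, ‹_›, ‹_›, ‹_›, ‹_›, ‹_›, ‹_›, ‹_›, ‹_›, ‹_›, ‹_›, ‹_›, ‹_›, ‹_›, bV, bV', ⟨ν⟩,
    isEmpty_diffeomorph_of_lemma12 bV bV' ν hS' fun Ψ hΨ => hD (hR' Ψ hΨ)⟩

/-- **The barrier from the leaves of Thm. A**: with a cork (`hK`, `akbulut1991_mazurCork`) and
Freedman–Quinn (`hF`), the four parts of Thm. A give `ContractibleBarrierFour`
(via `contractibleBarrierFour_of_theoremA` of `ExoticContractibleProofs.lean`).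
[cite: AkbulutRuberman2016, Thm. B and its proof (§3)] -/
theorem contractibleBarrierFour_of_parts (hK : akbulut1991_mazurCork.{u})
    (hC : akbulutRuberman2016_symmetryKillingCobordism.{u})
    (hG : exists_cobordismAttachment.{u})
    (hR : akbulutRuberman2016_relativelyExotic.{u})
    (hS : akbulutRuberman2016_boundaryDiffeosExtend.{u})
    (hF : freedmanQuinn1990_homeomorph_extends_contractible.{u}) :
    ContractibleBarrierFour.{u} :=
  contractibleBarrierFour_of_theoremA hK
    (akbulutRuberman2016_theoremA_contractible_of_parts hC hG hR hS) hF

end Literature.Barriers.SmoothPoincare4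

end
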